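import Summits.QuantumFields.YangMills.Theorems.IR.TensionRatioOfLoopFloor
import Summits.QuantumFields.YangMills.Theorems.IR.TorusWilsonLoopOddPlaquetteBound
import Summits.QuantumFields.YangMills.Theorems.IR.TensionStrongCoupling
import HarnessLib

/-!
# Crux `IR` (stmt-QuantumFields-19354), line `tension-ratio`: the registered rung T2-sc PROVED for the fundamental loops of
# special-unitary models, on the line's OWN odd tori — `ratioStrongCoupling_specialUnitary`; and the loop floor `LoopFloorSC` there

Helper module for item `stmt-QuantumFields-19354` (`--supports … --as helper`; it closes nothing).  The registered rung
`stub_rung_ratioStrongCoupling : RatioStrongCoupling` (T2-sc; `Theorems/IR/TensionRatioDefs.lean`) asks, for EVERY centre-charged continuous `π`,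
for ONE ratio constant `c` on all of `(0, β_D]` such that an area law `(C, s)` for the `π`-loops `torusRect` on all large ODD tori `2S+1` forces the
cold trace bound at rate `c√s`.  After input (a) (p600923) it is reduced to the loop floor `LoopFloorSC` (p601858).  This file DISCHARGES that floor,
and hence the rung itself, for the canonical centre-charged loop — the action's own fundamental representation of a special-unitary model
(`IsSpecialUnitaryModel r.ρ`, `N ≥ 2`, `π := r.ρ`) — with NO parity caveat:

* (dictionary, tree p590163 `torusRect_eq_wilsonExpectation`): the line's `torusRect ρ χ_π β S R T` IS Wave 0's `⟨W^π_{R×T}⟩_{Λ_{2S+1},β}`;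
* `loopFloor_specialUnitary`: `(c_pl β)^{n²} ≤ |torusRect r.ρ χ_ρ β S n n|` for `0 < β ≤ β₂`, `1 ≤ n ≤ S` — the odd-torus Seiler–Bachas bound
  `OddTorusRP.plaquette_pow_le_wilsonExpectation_wilsonLoop_odd` (p602802) on the plaquette floor `exists_plaquette_ge_linear` (p595411);
* `ratioStrongCoupling_specialUnitary`: the body of `RatioStrongCoupling` at `π = r.ρ`, for every compact `G` and every special-unitary lattice
  representation (`∃ c > 0, ∃ βD > 0, ∀ β ∈ (0, βD], ∀ s > 0, ∀ C, area law on all large odd tori ⇒ cold pressure at rate c√s on all large odd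
  tori`) — input (a) `StrongCouplingRate.coldPressureBound_strongCoupling_log` + the floor + the arithmetic `sqrt_rate_le_of_log_pow` (`k = 1`).

What remains of T2-sc: general centre-charged `π ≠ r.ρ` (the π-plaquette positivity floor `⟨χ_π(U_p)⟩ ≥ wβ^{k_π}` and the odd-torus Gram
inequalities for `π`-loops — `LoopFloorSC` in general).  HONEST FRAMING: a FORMAT rung inside `IR`'s known strong-coupling regime; `TensionFloor` ∕
`RatioFloorSC` untouched and OPEN; not consumed by `IR_of`; the YM mass gap (Clay) is NOT proved; `R4` closes only the conditional rung `BalabanLadder.UV`.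
-/

set_option autoImplicit false

noncomputable section

open MeasureTheory Filter Topology
open Literature.MathematicalPhysics Literature.MathematicalPhysics.QuantumFieldTheory Literature.MathematicalPhysics.QuantumLattice
open Literature.MathematicalPhysics.QuantumFieldTheory.Balaban1983to89.Sufficient (ColdPressureBound)
open Literature.MathematicalPhysics.QuantumFieldTheory.Balaban1983to89.Missing (strongCouplingRadius strongCouplingRadius_pos)
open Summit.QuantumFields.YangMills.Cruxes.IR.ColdPressurePincer
open Summit.QuantumFields.YangMills.Cruxes.IR.StrongCouplingRate (coldPressureBound_strongCoupling_log)
open Summit.QuantumFields.YangMills.Cruxes.IR.OddTorusRP (plaquette_pow_le_wilsonExpectation_wilsonLoop_odd)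

namespace Summit.QuantumFields.YangMills.Cruxes.IR.TensionRatio

/-! ## §1 (dictionary) `torusRect ρ χ_π β S R T = ⟨W^π_{R×T}⟩_{Λ_{2S+1},β}` is the tree's `torusRect_eq_wilsonExpectation`
(`Theorems/IR/TensionStrongCoupling.lean`, p590163). -/

/-! ## §2 The loop floor on odd tori for the fundamental loops of special-unitary models -/

section Floor

variable {G : Type} [Group G] [TopologicalSpace G] [IsTopologicalGroup G] [CompactSpace G]
  [MeasurableSpace G] [BorelSpace G]

/-- **`LoopFloorSC` for `π = r.ρ`, special-unitary model (`N ≥ 2`), exponent `k = 1`:** there are `βL > 0` and `w > 0` with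
`(wβ)^{n²} ≤ |torusRect r.ρ χ_ρ β S n n|` for all `β ∈ (0, βL]`, `1 ≤ n ≤ S` (plaquette floor `⟨W_{1×1}⟩ ≥ c_pl β` on every torus of side `≥ 3`,
then the odd-torus Seiler–Bachas bound `⟨W_{1×1}⟩^{n²} ≤ ⟨W_{n×n}⟩`). -/
theorem loopFloor_specialUnitary (r : LatticeRep G) (hSU : IsSpecialUnitaryModel r.ρ) (hN2 : 2 ≤ r.N) :
    ∃ βL : ℝ, 0 < βL ∧ ∃ w : ℝ, 0 < w ∧ ∀ β : ℝ, 0 < β → β ≤ βL → ∀ n : ℕ, 1 ≤ n → ∀ S : ℕ, n ≤ S →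
      (w * β) ^ (n * n) ≤ |torusRect r.ρ (fun g => normalisedCharacter r.N (r.ρ g)) β S n n| := by
  obtain ⟨β₂, cpl, hβ₂, hcpl, hpl⟩ := exists_plaquette_ge_linear r.ρ hSU hN2
  refine ⟨β₂, hβ₂, cpl, hcpl, fun β hβ0 hβ2 n hn S hnS => ?_⟩
  have hodd : Odd (2 * S + 1) := ⟨S, rfl⟩
  have hP := hpl β hβ0 hβ2 (2 * S + 1) (by omega)
  have hSB := plaquette_pow_le_wilsonExpectation_wilsonLoop_odd (d := 4) (L := 2 * S + 1) r.ρ (by norm_num) hodd (by omega)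
    r.continuous hβ0.le (show r.N ≠ 0 by omega) (h := n) (R := n) (by omega) (by omega)
  rw [torusRect_eq_wilsonExpectation]
  calc (cpl * β) ^ (n * n)
      ≤ wilsonExpectation r.ρ β (wilsonLoop r.ρ (0 : Site 4 (2 * S + 1)) 0 1 1 1) ^ (n * n) :=
        pow_le_pow_left₀ (mul_pos hcpl hβ0).le hP _
    _ ≤ wilsonExpectation r.ρ β (wilsonLoop r.ρ (0 : Site 4 (2 * S + 1)) 0 1 n n) := hSB
    _ ≤ _ := le_abs_self _

end Floor

/-! ## §3 The rung T2-sc for the fundamental loops of special-unitary models (odd tori, no parity caveat) -/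

/-- **T2-sc PROVED at `π = r.ρ` (special-unitary model, `N ≥ 2`), on the line's odd tori.**  For every compact `G` and every special-unitary
lattice representation `r` there are `c > 0` and `βD > 0` such that for ALL `β ∈ (0, βD]`, all `s > 0`, all `C`: an area law `(C, s)`
(`TorusAreaLaw`) for the fundamental loops on all large odd tori forces `ColdPressureBound r.ρ β S (c√s) C₀` on all odd tori.  Constants:
`βD = min βL r_ρ`, `κ₀ = −(1 + log r_ρ) − log w`, `c = 1/(8√(2 + max κ₀ 0))`, `C₀ = 28311552 e^{28311552}`; the area law and the floor at
`R = T = n ≤ S` cap `s ≤ −log(wβ) = (1 + log(r_ρ/β)) + κ₀`, and input (a) at rate `(1 + log(r_ρ/β))/8 ≥ c√s` is the conclusion.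
This is the body of the registered `RatioStrongCoupling` at the canonical centre-charged loop; general `π` remains (`LoopFloorSC`). -/
theorem ratioStrongCoupling_specialUnitary (G : Type) [Group G] [TopologicalSpace G] [IsTopologicalGroup G] [CompactSpace G]
    [MeasurableSpace G] [BorelSpace G] (r : LatticeRep G) (hSU : IsSpecialUnitaryModel r.ρ) (hN2 : 2 ≤ r.N) :
    ∃ c : ℝ, 0 < c ∧ ∃ βD : ℝ, 0 < βD ∧ ∀ β : ℝ, 0 < β → β ≤ βD → ∀ s : ℝ, 0 < s → ∀ C : ℝ,
      (∃ S₂ : ℕ, ∀ S : ℕ, S₂ ≤ S → TorusAreaLaw r.ρ (fun g => normalisedCharacter r.N (r.ρ g)) β S C s) →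
        ∃ C₀ : ℝ, 0 ≤ C₀ ∧ ∃ S₃ : ℕ, ∀ S : ℕ, S₃ ≤ S → ColdPressureBound r.ρ β S (c * Real.sqrt s) C₀ := by
  haveI : SecondCountableTopology G :=
    (r.continuous.isClosedEmbedding r.injective).isEmbedding.secondCountableTopology
  obtain ⟨βL, hβL, w, hw0, hfloor⟩ := loopFloor_specialUnitary r hSU hN2
  have hR0 := strongCouplingRadius_pos r.ρ
  obtain ⟨κ₀, hκ₀⟩ : ∃ κ₀ : ℝ, κ₀ = -((1 : ℕ) : ℝ) * (1 + Real.log (strongCouplingRadius r.ρ)) - Real.log w := ⟨_, rfl⟩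
  refine ⟨1 / (8 * Real.sqrt ((((1 : ℕ) : ℝ) + 1) + max κ₀ 0)), ?_, min βL (strongCouplingRadius r.ρ), lt_min hβL hR0,
    fun β hβ0 hββD s hs C hAL => ?_⟩
  · have : 0 < (((1 : ℕ) : ℝ) + 1) + max κ₀ 0 := by
      have h1 := le_max_right κ₀ 0
      push_cast
      linarith
    positivity
  have hβL' : β ≤ βL := hββD.trans (min_le_left _ _)
  have hβR : β ≤ strongCouplingRadius r.ρ := hββD.trans (min_le_right _ _)
  obtain ⟨S₂, hS₂⟩ := hAL
  -- (i) the rate cap `s ≤ -log (w β)` from the floor and the area law on a common large odd torus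
  have hwβ0 : 0 < w * β ^ (1 : ℕ) := mul_pos hw0 (pow_pos hβ0 1)
  have hcap : s ≤ -Real.log (w * β ^ (1 : ℕ)) := by
    refine rate_le_neg_log_of_areaLaw hwβ0 (D := |C| + 1) (by linarith [abs_nonneg C]) (n₀ := 1) fun n hn => ?_
    have hF := hfloor β hβ0 hβL' n hn (max S₂ n) (le_max_right _ _)
    have hA := hS₂ (max S₂ n) (le_max_left _ _) n n hn hn (le_max_right _ _) (le_max_right _ _)
    calc (w * β ^ (1 : ℕ)) ^ (n * n) = (w * β) ^ (n * n) := by rw [pow_one]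
      _ ≤ |torusRect r.ρ (fun g => normalisedCharacter r.N (r.ρ g)) β (max S₂ n) n n| := hF
      _ ≤ C ^ (2 * (n + n)) * Real.exp (-(s * n * n)) := hA
      _ ≤ (|C| + 1) ^ (2 * (n + n)) * Real.exp (-(s * n * n)) := by
          refine mul_le_mul_of_nonneg_right ?_ (Real.exp_pos _).le
          calc C ^ (2 * (n + n)) ≤ |C ^ (2 * (n + n))| := le_abs_self _
            _ = |C| ^ (2 * (n + n)) := abs_pow _ _
            _ ≤ (|C| + 1) ^ (2 * (n + n)) := pow_le_pow_left₀ (abs_nonneg _) (by linarith) _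
  -- (ii) input (a): cold pressure at rate `τ/8`, `τ = 1 + log(r_ρ/β)`, on every torus
  obtain ⟨τ, hτdef⟩ : ∃ τ : ℝ, τ = 1 + Real.log (strongCouplingRadius r.ρ / β) := ⟨_, rfl⟩
  have hq : 1 ≤ strongCouplingRadius r.ρ / β := by rw [le_div_iff₀ hβ0, one_mul]; exact hβR
  have hτ : 1 ≤ τ := by have := Real.log_nonneg hq; rw [hτdef]; linarith
  have hcp : ∀ S : ℕ, ColdPressureBound r.ρ β S (τ / 8) (28311552 * Real.exp 28311552) := fun S => by
    rw [hτdef]; exact coldPressureBound_strongCoupling_log r hβ0 hβR S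
  -- (iii) `-log (w β) = 1·τ + κ₀`
  have hℓ : -Real.log (w * β ^ (1 : ℕ)) = ((1 : ℕ) : ℝ) * τ + κ₀ := by
    rw [hτdef, hκ₀, Real.log_mul hw0.ne' (pow_pos hβ0 1).ne', Real.log_pow, Real.log_div hR0.ne' hβ0.ne']
    ring
  refine ⟨28311552 * Real.exp 28311552, by positivity, 0, fun S _ => coldPressureBound_mono_rate (hcp S) (by positivity) ?_⟩
  exact sqrt_rate_le_of_log_pow hτ hℓ hcap

end Summit.QuantumFields.YangMills.Cruxes.IR.TensionRatio

end
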